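import Literature.NumberTheory.EllipticCurves.SkinnerUrban2014.PAdicUnitImaginaryPeriodRatioProofs
import Literature.NumberTheory.EllipticCurves.SkinnerUrban2014.PAdicUnitPeriodRatioAnyPrimeProofs
import Literature.NumberTheory.EllipticCurves.BSDQuadraticDescentPeriodEliminationProofs
import HarnessLib

/-!
# Route `ThetaPartnerAtTwo`, crux K2r0P `SignedMainConjectureCMTwoRankZeroOfPub` (stmt-BirchSwinnertonDyer-24945),
# line `rankzero` v14, stub (μ♭)_A: the MINUS-PERIOD UNIT AT `p = 2` for curves of negative discriminant —
# `|Ω⁻(W)| = u · Ω⁻_f`, `‖u‖₂ = 1`, PROVED modulo the Manin constant of the optimal curve (Abbes–Ullmo)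

Cell `bsd-wall`, width seat `bsd-wall-tp2-p2-w3` (g2). THEOREMS ONLY (no `def`, no named fact, no `sorry`); helper `--supports`
the crux. BSD is not proved by any of this.

The imaginary-twist transport of FLAT (`…FlatTwistImaginary*`) displayed the hypothesis
H⁻(W): `W.imaginaryPeriodRat = ϖ · minusPeriod f_W`, `‖(ϖ : ℚ_2)‖ = 1`. The tree proves this at every ODD prime
(`SkinnerUrban2014.exists_unit_mul_minusPeriod_of_irreducible`), the only obstruction at `p = 2` being the lattice factor
`m ∣ 2` in `m · |Ω⁻(E₀)| = |c₀| · Ω⁻_f` (`exists_dvd_two_mul_imaginaryPeriodRat_eq_of_latticeEq`). Here: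

* §1 `numRealComponents_eq_of_isogeny_odd` — an isogeny of ODD degree between globally minimal models preserves the number
  of real components (hence the sign of `Δ`): parity bookkeeping on `qΩ₀ = aΩ₀'` (least real periods) and `q'Ω = a'Ω'`
  (full Néron periods), `q, a, q', a'` odd.
* §2 **`imaginaryPeriodRat_eq_abs_mul_minusPeriod_of_latticeEq`** — for a lattice-optimal datum (`Λ_{E₀} = c₀Λ_f`) of a
  curve with `Δ ≤ 0` (rhombic lattice): `|Ω⁻(E₀)| = |c₀| · Ω⁻_f` EXACTLY (`m = 1`): the half-period `Ω₀/2 + i|Ω⁻|/2` lies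
  in `Λ_{E₀}` (Lawden §6.16, tree `IsReal.discr_pos_of_halfPeriodI_add_notMem`), so `|Ω⁻|/2 ∈ im Λ_{E₀} = c₀ · ℤΩ⁻_f/2`.
  (For `Δ > 0` the factor is genuinely `2`: `im Λ = ℤ|Ω⁻|` for a rectangular lattice.)
* §3 **`exists_unit_mul_minusPeriod_two_of_delta_neg`** — `W` globally minimal, `E[2]` irreducible, `Δ(W) < 0`, `f` its
  newform, `2 ∤ c₀` ⇒ `|Ω⁻(W)| = u · Ω⁻_f`, `u = a|c₀|/q`, `‖u‖₂ = 1` (odd-degree isogeny to the optimal curve, §1, §2).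
* §4 `imaginaryPeriodRat_eq_unit_mul_minusPeriod_two_of_abbesUllmo` — the same for `W` GOOD at `2`, from the named fact
  `abbesUllmo_not_dvd_maninConstant_of_not_dvd_level` (Abbes–Ullmo 1996 Thm. A, the print input behind the PUB fact
  `realPeriodRat_eq_unit_mul_plusPeriod_two`): H⁻(W) for every curve of the K2r0P habitat (`GoodSS W 2`, `Δ(W) < 0`).

References: R. Greenberg, V. Vatsal, Invent. Math. 142 (2000) §3 Rem. 3.4 [GreenbergVatsal2000]; A. Abbes, E. Ullmo,
Compositio Math. 103 (1996) Thm. A [AbbesUllmo1996]; B. Edixhoven, Progr. Math. 89 (1991) Prop. 2, §1 [EdixhovenManin1991];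
J. E. Cremona, *Algorithms for modular elliptic curves* (1997) §2.8 [CremonaAlgorithms1997]; D. F. Lawden, *Elliptic
Functions and Applications* (1989) §6.16 [Lawden1989]; V. Pal, Proc. AMS 140 (2012) p. 1514 [Pal2012].
-/

set_option autoImplicit false
-- the Theorems namespace of this sub repeats the summit name by design (D-0017 nested layout)
set_option linter.dupNamespace false

noncomputable section

open scoped Classical MatrixGroups ModularForm

open Complex CongruenceSubgroup WeierstrassCurve Literature.NumberTheory.EllipticCurves
  Literature.NumberTheory.EllipticCurves.ModularForms Literature.NumberTheory.EllipticCurves.SkinnerUrban2014 PeriodPair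

namespace Summit.BirchSwinnertonDyer.BirchSwinnertonDyer.Theorems.FlatTwist.Imaginary

/-- For an integer `z` not divisible by `2`, `‖z‖₂ = 1`. [folklore] -/
private theorem padicNorm_intCast_eq_one_of_not_two_dvd {z : ℤ} (h : ¬ (2 : ℤ) ∣ z) : ‖(z : ℚ_[2])‖ = 1 :=
  le_antisymm (Padic.norm_int_le_one z)
    (not_lt.mp fun hlt ↦ h (by exact_mod_cast (Padic.norm_intCast_lt_one_iff (p := 2)).mp hlt))

section Lattice

variable {W W' : WeierstrassCurve ℚ} [W.IsElliptic] [W'.IsElliptic] {N N' : ℕ} [NeZero N] [NeZero N']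

/-! ## §1. Odd isogenies preserve the number of real components -/

/-- **An isogeny of ODD degree between globally minimal models preserves the number of real components** (hence the sign
of the discriminant): with `qΩ₀ = aΩ₀'` for the least real periods (`exists_int_mul_minRealPeriod_eq_of_isogeny`) and
`q'Ω = a'Ω'` for the Néron periods `Ω = c_∞Ω₀`, `Ω' = c_∞'Ω₀'` (`exists_int_mul_realPeriodRat_eq_of_isogeny`), all of
`q, a, q', a'` dividing the odd degree, `q' c_∞ a = q a' c_∞'` forces `c_∞ = c_∞'`.
[cite: GreenbergVatsal2000, §3, Remark 3.4] [cite: CremonaAlgorithms1997, §2.8 (p. 26)] -/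
theorem numRealComponents_eq_of_isogeny_odd [W.IsGloballyMinimal] [W'.IsGloballyMinimal]
    (D : ModularParametrizationData W N) (D' : ModularParametrizationData W' N') (ψ : Isogeny W W')
    (hodd : Odd ψ.degree) :
    (W.baseChange ℝ).numRealComponents = (W'.baseChange ℝ).numRealComponents := by
  obtain ⟨q, a, b, -, hqd, hab, hqa⟩ := exists_int_mul_minRealPeriod_eq_of_isogeny D D' ψ
  obtain ⟨q', a', b', -, hqd', hab', hqa'⟩ := exists_int_mul_realPeriodRat_eq_of_isogeny D D' ψ
  have hdo : Odd (ψ.degree : ℤ) := by exact_mod_cast hodd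
  have oddOfDvd : ∀ {x : ℤ}, x ∣ (ψ.degree : ℤ) → Odd x := fun ⟨c, hc⟩ ↦
    (Int.odd_mul.mp (hc ▸ hdo)).1
  have hqo : Odd q := oddOfDvd hqd
  have hqo' : Odd q' := oddOfDvd hqd'
  have hao : Odd a := oddOfDvd ⟨b, hab.symm⟩
  have hao' : Odd a' := oddOfDvd ⟨b', hab'.symm⟩
  set n := (W.baseChange ℝ).numRealComponents with hn_def
  set n' := (W'.baseChange ℝ).numRealComponents with hn'_def
  have hn := D.realPeriodRat_eq_numRealComponents_mul
  have hn' := D'.realPeriodRat_eq_numRealComponents_mul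
  -- `Ω₀' ≠ 0`
  have hΩ' : 0 < W'.realPeriodRat := W'.realPeriodRat_pos_holds
  have hΩ₀' : D'.L.minRealPeriod ≠ 0 := by
    intro h
    rw [h, mul_zero] at hn'
    exact hΩ'.ne' hn'
  -- `q' n a Ω₀' = q a' n' Ω₀'`
  have key : ((q' * n * a : ℤ) : ℝ) = ((q * a' * n' : ℤ) : ℝ) := by
    have h1 : (q' : ℝ) * (n * D.L.minRealPeriod) = a' * (n' * D'.L.minRealPeriod) := by
      rw [← hn, ← hn']; exact hqa'
    have h2 : ((q' : ℝ) * n * a) * D'.L.minRealPeriod = ((q : ℝ) * a' * n') * D'.L.minRealPeriod := by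
      have h3 : (q : ℝ) * ((q' : ℝ) * (n * D.L.minRealPeriod)) = q * (a' * (n' * D'.L.minRealPeriod)) := by rw [h1]
      calc ((q' : ℝ) * n * a) * D'.L.minRealPeriod = (q' : ℝ) * n * (a * D'.L.minRealPeriod) := by ring
        _ = (q' : ℝ) * n * (q * D.L.minRealPeriod) := by rw [hqa]
        _ = q * ((q' : ℝ) * (n * D.L.minRealPeriod)) := by ring
        _ = ((q : ℝ) * a' * n') * D'.L.minRealPeriod := by rw [h3]; ring
    have := mul_right_cancel₀ hΩ₀' h2
    push_cast
    linarith
  have keyZ : q' * n * a = q * a' * n' := by exact_mod_cast key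
  -- `n, n' ∈ {1, 2}`: compare parities
  have hcases : ∀ V : WeierstrassCurve ℚ, (V.baseChange ℝ).numRealComponents = 1 ∨ (V.baseChange ℝ).numRealComponents = 2 :=
    fun V ↦ by rw [V.numRealComponents_baseChange_real]; split_ifs <;> simp
  rcases hcases W with h1 | h1 <;> rcases hcases W' with h2 | h2
  · exact h1.trans h2.symm
  · exfalso
    rw [← hn_def] at h1; rw [← hn'_def] at h2
    rw [h1, h2] at keyZ
    push_cast at keyZ
    have hl : Odd (q' * 1 * a) := (hqo'.mul odd_one).mul hao
    rw [keyZ] at hl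
    exact (Int.not_even_iff_odd.mpr hl) ⟨q * a', by ring⟩
  · exfalso
    rw [← hn_def] at h1; rw [← hn'_def] at h2
    rw [h1, h2] at keyZ
    push_cast at keyZ
    have hr : Odd (q * a' * 1) := (hqo.mul hao').mul odd_one
    rw [← keyZ] at hr
    exact (Int.not_even_iff_odd.mpr hr) ⟨q' * a, by ring⟩
  · exact h1.trans h2.symm

/-! ## §2. The optimal curve with `Δ ≤ 0`: `|Ω⁻(E₀)| = |c₀| · Ω⁻_f` exactly -/

/-- **The imaginary period of a lattice-optimal datum against `Ω⁻_f`, EXACTLY, for a rhombic lattice.** For a lattice-optimal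
datum `D₀` (`Λ_{E₀} = c₀Λ_f`) of an elliptic `W₀` with `Δ(W₀) ≤ 0`: `|Ω⁻(W₀)| = |c₀| · Ω⁻_f` (the factor `m ∣ 2` of
`exists_dvd_two_mul_imaginaryPeriodRat_eq_of_latticeEq` is `1`). The half-period `i|Ω⁻|/2 + Ω₀/2` lies in `Λ_{E₀}` (else the
lattice is rectangular and `Δ > 0`, `IsReal.discr_pos_of_halfPeriodI_add_notMem`), so `|Ω⁻|/2 ∈ im Λ_{E₀} = c₀ · ℤ · Ω⁻_f/2`, i.e.
`|Ω⁻| = c₀ j Ω⁻_f`; with `m|Ω⁻| = |c₀|Ω⁻_f`, `m ∈ {1,2}`, the case `m = 2` would give `2|j| = 1`.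
[cite: EdixhovenManin1991, Prop. 2 and §1] [cite: CremonaAlgorithms1997, §2.8 (p. 26)] [cite: Lawden1989, §6.16] -/
theorem imaginaryPeriodRat_eq_abs_mul_minusPeriod_of_latticeEq (D₀ : ModularParametrizationData W N)
    (hopt : ∀ z ∈ D₀.L.lattice, ∃ w ∈ periodLattice D₀.f, z = D₀.c * w) (hΔ : ¬ 0 < W.Δ) :
    W.imaginaryPeriodRat = |(D₀.c : ℝ)| * minusPeriod D₀.f := by
  haveI : (W.baseChange ℝ).IsElliptic := by
    rw [WeierstrassCurve.baseChange]; infer_instance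
  obtain ⟨m, hm2, hm⟩ := exists_dvd_two_mul_imaginaryPeriodRat_eq_of_latticeEq D₀ hopt
  have hc0 : D₀.c ≠ 0 := D₀.maninConstant_ne_zero_holds
  have hminus : 0 < minusPeriod D₀.f :=
    IsNewform0.minusPeriod_pos_holds D₀.isNewformOf.1 D₀.isNewformOf.coeffField_eq_bot
  have him : imagPeriods D₀.f = AddSubgroup.zmultiples (minusPeriod D₀.f / 2) :=
    imagPeriods_eq_zmultiples_of_minusPeriod_pos D₀.f hminus
  -- the rhombic half-period
  have hR : D₀.L.IsReal := D₀.isReal_neronLattice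
  have hΔR : ¬ 0 < (W.baseChange ℝ).Δ := by
    have hΔ' : (W.baseChange ℝ).Δ = (W.Δ : ℝ) := by simp [WeierstrassCurve.baseChange, WeierstrassCurve.map_Δ]
    rw [hΔ']; exact_mod_cast hΔ
  have hdisc : D₀.L.g₂.re ^ 3 - 27 * D₀.L.g₃.re ^ 2 ≠ 0 := by
    rw [D₀.discr_neronLattice]; exact (W.baseChange ℝ).isUnit_Δ.ne_zero
  have hmem : I * ((((D₀.L.mulLeft I I_ne_zero).minRealPeriod / 2 : ℝ)) : ℂ) +
      ((D₀.L.minRealPeriod / 2 : ℝ) : ℂ) ∈ D₀.L.lattice := by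
    by_contra hnot
    exact hΔR (by rw [← D₀.discr_neronLattice]; exact hR.discr_pos_of_halfPeriodI_add_notMem hdisc hnot)
  set Ω₁ := W.imaginaryPeriodRat with hΩ₁
  have hpos : 0 < Ω₁ := W.imaginaryPeriodRat_pos
  have hΩI : (D₀.L.mulLeft I I_ne_zero).minRealPeriod = Ω₁ := (imaginaryPeriodRat_eq_minRealPeriod_mulLeft_I D₀).symm
  -- `Ω₁/2 = c₀ · im w`, `im w = j Ω⁻_f/2`
  obtain ⟨w, hw, hzw⟩ := hopt _ hmem
  have hwim : w.im ∈ imagPeriods D₀.f := by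
    rw [imagPeriods, AddSubgroup.mem_map]
    exact ⟨w, hw, rfl⟩
  rw [him, AddSubgroup.mem_zmultiples_iff] at hwim
  obtain ⟨j, hj⟩ := hwim
  have h1 : Ω₁ / 2 = D₀.c * w.im := by
    have := congrArg Complex.im hzw
    rw [hΩI] at this
    simpa using this
  have h2 : Ω₁ = 2 * D₀.c * (j * (minusPeriod D₀.f / 2)) := by
    rw [← hj, zsmul_eq_mul] at h1; linarith
  rcases (Nat.dvd_prime Nat.prime_two).mp hm2 with rfl | rfl
  · simpa using hm
  · exfalso
    -- `2 Ω₁ = |c₀| Ω⁻_f` and `Ω₁ = c₀ j Ω⁻_f` give `2 c₀ j = |c₀|`, i.e. `2|j| = 1`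
    have h3 : (2 * (D₀.c * j) : ℝ) * minusPeriod D₀.f = |(D₀.c : ℝ)| * minusPeriod D₀.f := by
      rw [← hm, h2]; push_cast; ring
    have h4 : (2 * (D₀.c * j) : ℝ) = |(D₀.c : ℝ)| := mul_right_cancel₀ hminus.ne' h3
    have h5 : ((2 * (D₀.c * j) : ℤ) : ℝ) = ((|D₀.c| : ℤ) : ℝ) := by push_cast; exact h4
    have h6 : 2 * (D₀.c * j) = |D₀.c| := by exact_mod_cast h5
    have h7 : |D₀.c| = 2 * (|D₀.c| * |j|) := by
      conv_lhs => rw [← abs_abs, ← h6]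
      rw [abs_mul, abs_mul, abs_two]
    have hcpos : 0 < |D₀.c| := abs_pos.mpr hc0
    have hj1 : 1 = 2 * |j| := by nlinarith
    omega

/-! ## §3. Assembly at `p = 2` for `Δ(W) < 0` -/

/-- **Greenberg–Vatsal 2000, §3, Remark 3.4 for the IMAGINARY period AT `p = 2`, for curves of NEGATIVE discriminant, PROVED
modulo the Manin constant of the optimal curve.** `W/ℚ` globally minimal, `E[2]` irreducible, `Δ(W) < 0`, `f` the newform of `W`,
and (`hc`) `2 ∤ c₀` for the lattice-optimal datum at the level of `f` ⟹ `|Ω⁻(W)| = u·Ω⁻_f`, `u = a|c₀|/q ∈ ℚ`, `‖u‖₂ = 1`: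
the optimal datum `D₀` on `W₀ ~ W` (`exists_optimalDatum_of_edixhoven`), an isogeny `W → W₀` of ODD degree
(`exists_isogeny_not_dvd_degree_of_irreducible`) — so `q, a` are odd and `Δ(W₀) < 0` too (§1) — then
`exists_int_mul_imaginaryPeriodRat_eq_of_isogeny` and §2. The odd-`p` version (any sign of `Δ`) is the tree's
`exists_unit_mul_minusPeriod_of_irreducible`. [cite: GreenbergVatsal2000, §3, Remark 3.4] [cite: EdixhovenManin1991, Prop. 2 and §1] -/
theorem exists_unit_mul_minusPeriod_two_of_delta_neg (W : WeierstrassCurve ℚ) [W.IsElliptic] [W.IsGloballyMinimal]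
    (hirr : W.HasIrreducibleModPGaloisRep 2) (hΔ : W.Δ < 0) (f : CuspForm (Gamma0 N) 2) (hf : IsNewformOf W f)
    (hc : ∀ (W₀ : WeierstrassCurve ℚ) [W₀.IsElliptic] [W₀.IsGloballyMinimal]
      (D₀ : ModularParametrizationData W₀ N), D₀.f = f →
      (∀ z ∈ D₀.L.lattice, ∃ w ∈ periodLattice D₀.f, z = D₀.c * w) → ¬ (2 : ℤ) ∣ D₀.maninConstant) :
    ∃ u : ℚ, ‖(u : ℚ_[2])‖ = 1 ∧ W.imaginaryPeriodRat = u * minusPeriod f := by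
  haveI : Fact (Nat.Prime 2) := ⟨Nat.prime_two⟩
  obtain ⟨D⟩ := Literature.NumberTheory.Automorphic.nonempty_modularParametrizationData_of_isNewformOf hf
  have hDf : D.f = f := D.isNewformOf.unique hf
  subst hDf
  obtain ⟨W₀, hW₀, hW₀', D₀, hf₀, hiso, hopt, -⟩ :=
    D.exists_optimalDatum_of_edixhoven
      (fun hf' hL' q hq hq' ↦ edixhoven_int_of_neronLattice_eq_smul_periodLattice_holds hf' hL' q hq hq')
  have hc₀ : ¬ (2 : ℤ) ∣ D₀.c := hc W₀ D₀ hf₀ hopt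
  obtain ⟨ψ, hψ⟩ := exists_isogeny_not_dvd_degree_of_irreducible (W := W) (W' := W₀)
    (by norm_num : ((2 : ℕ) : ℚ) ≠ 0) hirr hiso
  obtain ⟨q, a, b, hq0, hqd, hab, hqa⟩ := exists_int_mul_imaginaryPeriodRat_eq_of_isogeny D D₀ ψ
  -- `Δ(W₀) < 0` as well
  have hodd : Odd ψ.degree := Nat.odd_iff.mpr (Nat.two_dvd_ne_zero.mp hψ)
  have hn := numRealComponents_eq_of_isogeny_odd D D₀ ψ hodd
  have hΔ₀ : ¬ 0 < W₀.Δ := by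
    intro h
    rw [W.numRealComponents_baseChange_real, W₀.numRealComponents_baseChange_real, if_neg (not_lt.mpr hΔ.le),
      if_pos h] at hn
    exact absurd hn (by decide)
  have hm := imaginaryPeriodRat_eq_abs_mul_minusPeriod_of_latticeEq D₀ hopt hΔ₀
  rw [hf₀] at hm
  have hq0' : (q : ℝ) ≠ 0 := by exact_mod_cast hq0
  have hpa : ¬ (2 : ℤ) ∣ a := fun h ↦ hψ (Int.natCast_dvd_natCast.mp (hab ▸ h.mul_right b))
  have hpq : ¬ (2 : ℤ) ∣ q := fun h ↦ hψ (Int.natCast_dvd_natCast.mp (h.trans hqd))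
  have hpc : ¬ (2 : ℤ) ∣ |D₀.c| := fun h ↦ hc₀ ((dvd_abs _ _).mp h)
  refine ⟨((a : ℚ) * (|D₀.c| : ℤ)) / (q : ℚ), ?_, ?_⟩
  · have e : ((((a : ℚ) * (|D₀.c| : ℤ)) / (q : ℚ) : ℚ) : ℚ_[2]) =
        ((a : ℚ_[2]) * ((|D₀.c| : ℤ) : ℚ_[2])) / (q : ℚ_[2]) := by
      simp only [Rat.cast_div, Rat.cast_mul, Rat.cast_intCast]
    rw [e, norm_div, norm_mul, padicNorm_intCast_eq_one_of_not_two_dvd hpa,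
      padicNorm_intCast_eq_one_of_not_two_dvd hpc, padicNorm_intCast_eq_one_of_not_two_dvd hpq]
    norm_num
  · rw [← Int.cast_abs] at hm
    have h1 : W.imaginaryPeriodRat * (q : ℝ) = ((a : ℝ) * ((|D₀.c| : ℤ) : ℝ)) * minusPeriod D.f := by
      calc W.imaginaryPeriodRat * (q : ℝ) = (q : ℝ) * W.imaginaryPeriodRat := mul_comm _ _
        _ = a * W₀.imaginaryPeriodRat := hqa
        _ = ((a : ℝ) * ((|D₀.c| : ℤ) : ℝ)) * minusPeriod D.f := by rw [hm]; ring
    have hcast : ((((a : ℚ) * (|D₀.c| : ℤ)) / (q : ℚ) : ℚ) : ℝ) =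
        ((a : ℝ) * ((|D₀.c| : ℤ) : ℝ)) / (q : ℝ) := by
      simp only [Rat.cast_div, Rat.cast_mul, Rat.cast_intCast]
    rw [hcast, div_mul_eq_mul_div, eq_div_iff hq0']
    exact h1

end Lattice

/-! ## §4. From Abbes–Ullmo (the print input behind the PUB fact `realPeriodRat_eq_unit_mul_plusPeriod_two`) -/

/-- **The minus-period unit at `p = 2` for GOOD reduction at `2`, `E[2]` irreducible and `Δ(W) < 0`, from Abbes–Ullmo 1996
Thm. A** (named fact `abbesUllmo_not_dvd_maninConstant_of_not_dvd_level`, NOT discharged here): `|Ω⁻(W)| = u · Ω⁻_f`, `u ∈ ℚ`,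
`‖u‖₂ = 1` — the hypothesis H⁻(W) of `…FlatTwistImaginary*` for every curve of the K2r0P habitat.
[cite: AbbesUllmo1996, Thm. A] [cite: GreenbergVatsal2000, §3, Remark 3.4] [cite: Pal2012, p. 1514] -/
theorem imaginaryPeriodRat_eq_unit_mul_minusPeriod_two_of_abbesUllmo
    (hAU : abbesUllmo_not_dvd_maninConstant_of_not_dvd_level) (W : WeierstrassCurve ℚ) [W.IsElliptic]
    [W.IsGloballyMinimal] (hgood : W.HasGoodReductionAtPrime 2) (hirr : W.HasIrreducibleModPGaloisRep 2) (hΔ : W.Δ < 0)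
    {N : ℕ} [NeZero N] (f : CuspForm (Gamma0 N) 2) (hf : IsNewformOf W f) :
    ∃ u : ℚ, ‖(u : ℚ_[2])‖ = 1 ∧ W.imaginaryPeriodRat = u * minusPeriod f :=
  haveI : Fact (Nat.Prime 2) := ⟨Nat.prime_two⟩
  exists_unit_mul_minusPeriod_two_of_delta_neg W hirr hΔ f hf fun W₀ _ _ D₀ _ hopt ↦
    hAU W₀ D₀ hopt 2 Nat.prime_two (not_dvd_level_of_hasGoodReductionAtPrime hgood hf)

end Summit.BirchSwinnertonDyer.BirchSwinnertonDyer.Theorems.FlatTwist.Imaginary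

end
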